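import Literature.MathematicalPhysics.KineticTheory.LangevinChainSDE
import Mathlib.Analysis.Calculus.MeanValue
import Mathlib.Topology.MetricSpace.ProperSpace.Lemmas
import HarnessLib

/-!
# The high-energy scaling limit of the pinned chain: the quartic Hamiltonian flow and its dissipation

Trunk T-KINETIC (Literature/MathematicalPhysics/KineticTheory). Cuneo–Eckmann–Hairer–Rey-Bellet,
EJP 23 (2018) no. 55, §5.1 (arXiv:1712.09413 pp. 24–27), for the pinned anharmonic chain
`pinnedChain ω₂ lam β γ` (`U = ω₂q²/2 + lam q⁴/4`, `V = r²/2 + βr⁴/4`; degrees `ℓ_p = ℓ_i = 4` when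
`lam > 0`). At energy `E = a⁴` the rescaled variables (5.18) `p̃ = a⁻² p`, `q̃ = a⁻¹ q`
(time `σ = a t`) have the Hamiltonian (5.20) `H̃ = ∑ p̃²/2 + ∑ a⁻⁴U(a q̃) + ∑ a⁻⁴V(a δq̃)`, i.e. the
chain with potentials `ε ω₂ q²/2 + lam q⁴/4`, `ε r²/2 + β r⁴/4`, `ε = a⁻²`, which converges as
`E → ∞` to the **limiting Hamiltonian** (5.22) `Ĥ = ∑ p²/2 + ∑ lam q⁴/4 + ∑ β(δq)⁴/4` and the
deterministic limiting system (5.32) `dq̂ = p̂ dσ`, `dp̂ = -∇Ĥ dσ`. This file provides: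

* `scaledChain ω₂ lam β ε` — the chain with the rescaled potentials (`γ = 0`); `ε = 0` is the
  limiting quartic chain; `OscillatorChain.rescale a` — the scaling map; and the identities
  `H = a⁴ H̃_{a⁻²} ∘ rescale` (`pinnedChain_hamiltonian_eq_scaled`) and
  `a⁻³ ∂_{q_i}H = ∂_{q̃_i}H̃_{a⁻²} ∘ rescale` (`pinnedChain_dPotential_eq_scaled`).
* `OscillatorChain.dPotential_eq_closed` — the closed form
  `∂Φ/∂q_i = U'(q_i) + [0<i] V'(q_i - q_{i-1}) - [i+1<N] V'(q_{i+1} - q_i)`, and the Euler identity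
  `∑_i q_i ∂Φ̂/∂q_i = 4 Φ̂` for the quartic potential (`scaledChain_zero_euler`).
* `limitFlow ω₂ lam β N x` — **the flow of the limiting system (5.32)** for the quartic chain (`lam, β`;
  no friction term since `ℓ_i = 4 ≠ 2`), constructed by truncation (the Picard solution of
  `LangevinChainSDE.lean` with zero noise) and **energy conservation** (`hamiltonian_limitFlow`):
  for `Ĥ(x) ≤ 4` it solves the untruncated equation (`limitFlow_eq_integral`,
  `hasDerivAt_limitFlowExt`), is continuous in time and jointly continuous in `(x, σ)`
  (`continuous_limitFlow_uncurry`).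
* `exists_pos_le_dissipation_limitFlow` — **CEHR Proposition 5.14 for the pinned chain**
  (`lam, β > 0`): there is `C > 0` such that for every initial condition with `Ĥ(ẑ₀) ∈ [h₁, h₂]`
  (`0 < h₁`, `h₂ ≤ 4`) the solution of (5.32) satisfies `∫₀^Λ p̂_0(σ)² dσ ≥ C` — positivity by the
  propagation argument of the printed proof (if `p̂_0 ≡ 0` on `[0, Λ]` then site by site all
  masses stand still and all forces vanish, so `Ĥ(ẑ₀) = 0` by Euler's identity; Condition C4 is
  the injectivity of `r ↦ βr³`), uniformity by compactness of `{Ĥ ∈ [h₁, h₂]}` and continuity in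
  the initial condition.

## References

* N. Cuneo, J.-P. Eckmann, M. Hairer, L. Rey-Bellet, *Non-equilibrium steady states for networks of
  oscillators*, EJP 23 (2018) no. 55 (arXiv:1712.09413), §5.1: (5.18), (5.20)–(5.22), (5.32),
  Prop. 5.14 and its proof, Remark 5.15.
* L. Rey-Bellet, L. E. Thomas, *Exponential convergence to non-equilibrium stationary states in
  classical statistical mechanics*, CMP 225 (2002) 305–329, §3 (the scaling argument).
-/

noncomputable section

open MeasureTheory Filter Topology Set Metric
open scoped NNReal

namespace Literature.MathematicalPhysics.KineticTheory.HeatConduction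

open OscillatorChain Literature.Analysis.ODE

variable {N : ℕ}

/-! ### The rescaled chains and the scaling identities -/

/-- The **rescaled pinned chain** at scale `ε = E^{-1/2}` (CEHR (5.20)): potentials
`ε ω₂ q²/2 + lam q⁴/4` and `ε r²/2 + β r⁴/4`, no bath friction (`γ = 0`; the friction of the
rescaled system (5.21), `E^{1/ℓ_i - 1/2} γ p̃`, is treated as a perturbation). For `ε = 0` this is
the limiting quartic chain with Hamiltonian `Ĥ` of (5.22).
[cite: CuneoEckmannHairerReyBellet2018, §5.1 eq. (5.20) and (5.22)] -/
def scaledChain (ω₂ lam β ε : ℝ) : OscillatorChain where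
  U q := ε * ω₂ * q ^ 2 / 2 + lam * q ^ 4 / 4
  V r := ε * r ^ 2 / 2 + β * r ^ 4 / 4
  γ := 0

section ScaledChain

variable (ω₂ lam β ε : ℝ)

/-- The rescaled pinning potential is smooth. [folklore] -/
theorem scaledChain_contDiff_U {n : WithTop ℕ∞} : ContDiff ℝ n (scaledChain ω₂ lam β ε).U := by
  show ContDiff ℝ n fun q : ℝ => ε * ω₂ * q ^ 2 / 2 + lam * q ^ 4 / 4
  fun_prop

/-- The rescaled interaction potential is smooth. [folklore] -/
theorem scaledChain_contDiff_V {n : WithTop ℕ∞} : ContDiff ℝ n (scaledChain ω₂ lam β ε).V := by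
  show ContDiff ℝ n fun r : ℝ => ε * r ^ 2 / 2 + β * r ^ 4 / 4
  fun_prop

/-- `U_ε'(q) = ε ω₂ q + lam q³`. [folklore] -/
theorem scaledChain_deriv_U (q : ℝ) : deriv (scaledChain ω₂ lam β ε).U q = ε * ω₂ * q + lam * q ^ 3 := by
  show deriv (fun q => ε * ω₂ * q ^ 2 / 2 + lam * q ^ 4 / 4) q = _
  have h : HasDerivAt (fun q => ε * ω₂ * q ^ 2 / 2 + lam * q ^ 4 / 4)
      (ε * ω₂ * (2 * q ^ 1 * 1) / 2 + lam * (4 * q ^ 3 * 1) / 4) q :=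
    ((((hasDerivAt_id q).pow 2).const_mul (ε * ω₂)).div_const 2).add
      ((((hasDerivAt_id q).pow 4).const_mul lam).div_const 4)
  rw [h.deriv]
  ring

/-- `V_ε'(r) = ε r + β r³`. [folklore] -/
theorem scaledChain_deriv_V (r : ℝ) : deriv (scaledChain ω₂ lam β ε).V r = ε * r + β * r ^ 3 := by
  show deriv (fun r => ε * r ^ 2 / 2 + β * r ^ 4 / 4) r = _
  have h : HasDerivAt (fun r => ε * r ^ 2 / 2 + β * r ^ 4 / 4)
      (ε * (2 * r ^ 1 * 1) / 2 + β * (4 * r ^ 3 * 1) / 4) r :=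
    ((((hasDerivAt_id r).pow 2).const_mul ε).div_const 2).add
      ((((hasDerivAt_id r).pow 4).const_mul β).div_const 4)
  rw [h.deriv]
  ring

/-- The rescaled chain has no bath friction. [folklore] -/
@[simp] theorem scaledChain_γ : (scaledChain ω₂ lam β ε).γ = 0 := rfl

/-- The Hamiltonian of the rescaled chain is smooth. [folklore] -/
theorem scaledChain_contDiff_hamiltonian (N : ℕ) {n : WithTop ℕ∞} :
    ContDiff ℝ n ((scaledChain ω₂ lam β ε).hamiltonian N) :=
  (scaledChain ω₂ lam β ε).contDiff_hamiltonian (scaledChain_contDiff_U ω₂ lam β ε)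
    (scaledChain_contDiff_V ω₂ lam β ε) N

/-- The drift of the rescaled chain is smooth. [folklore] -/
theorem scaledChain_contDiff_drift (N : ℕ) {n : ℕ∞} :
    ContDiff ℝ n ((scaledChain ω₂ lam β ε).drift N) :=
  ((scaledChain ω₂ lam β ε).contDiff_drift (scaledChain_contDiff_U ω₂ lam β ε)
    (scaledChain_contDiff_V ω₂ lam β ε) N).of_le (by exact_mod_cast le_top)

/-- The drift of the rescaled chain is the Hamiltonian vector field `(p, -∇Φ_ε)`. [folklore] -/
theorem scaledChain_drift_apply (N : ℕ) (x : PhaseSpace N) :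
    (scaledChain ω₂ lam β ε).drift N x = (x.2, fun i => -(scaledChain ω₂ lam β ε).dPotential N i x.1) := by
  rw [(scaledChain ω₂ lam β ε).drift_eq ((scaledChain_contDiff_U ω₂ lam β ε (n := 1)).differentiable
    one_ne_zero) ((scaledChain_contDiff_V ω₂ lam β ε (n := 1)).differentiable one_ne_zero)]
  simp

/-- The Hamiltonian of the rescaled chain is nonnegative (`ε, εω₂, lam, β ≥ 0`). [folklore] -/
theorem scaledChain_hamiltonian_nonneg (hε : 0 ≤ ε) (hω : 0 ≤ ε * ω₂) (hl : 0 ≤ lam) (hβ : 0 ≤ β)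
    (N : ℕ) (x : PhaseSpace N) : 0 ≤ (scaledChain ω₂ lam β ε).hamiltonian N x := by
  unfold OscillatorChain.hamiltonian scaledChain
  refine add_nonneg (Finset.sum_nonneg fun i _ => ?_)
    (Finset.sum_nonneg fun i _ => Finset.sum_nonneg fun j _ => ?_)
  · have : 0 ≤ ε * ω₂ * x.1 i ^ 2 / 2 := by positivity
    positivity
  · split_ifs
    · positivity
    · exact le_rfl

/-- `p_i²/2 ≤ H̃_ε` and `lam q_i⁴/4 ≤ H̃_ε` (`ε, εω₂, lam, β ≥ 0`). [folklore] -/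
theorem scaledChain_sq_le_hamiltonian (hε : 0 ≤ ε) (hω : 0 ≤ ε * ω₂) (hl : 0 ≤ lam) (hβ : 0 ≤ β)
    (N : ℕ) (x : PhaseSpace N) (i : Fin N) :
    x.2 i ^ 2 / 2 ≤ (scaledChain ω₂ lam β ε).hamiltonian N x ∧
      lam * x.1 i ^ 4 / 4 ≤ (scaledChain ω₂ lam β ε).hamiltonian N x := by
  unfold OscillatorChain.hamiltonian
  have h2 : 0 ≤ ∑ i : Fin N, ∑ j : Fin N,
      (if j.val = i.val + 1 then (scaledChain ω₂ lam β ε).V (x.1 j - x.1 i) else 0) := by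
    refine Finset.sum_nonneg fun i _ => Finset.sum_nonneg fun j _ => ?_
    split_ifs
    · show 0 ≤ ε * (x.1 j - x.1 i) ^ 2 / 2 + β * (x.1 j - x.1 i) ^ 4 / 4; positivity
    · exact le_rfl
  have hterm : ∀ j, 0 ≤ x.2 j ^ 2 / 2 + (scaledChain ω₂ lam β ε).U (x.1 j) := fun j => by
    show 0 ≤ x.2 j ^ 2 / 2 + (ε * ω₂ * x.1 j ^ 2 / 2 + lam * x.1 j ^ 4 / 4)
    have : 0 ≤ ε * ω₂ * x.1 j ^ 2 / 2 := by positivity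
    positivity
  have h1 : x.2 i ^ 2 / 2 + (scaledChain ω₂ lam β ε).U (x.1 i) ≤
      ∑ j, (x.2 j ^ 2 / 2 + (scaledChain ω₂ lam β ε).U (x.1 j)) :=
    Finset.single_le_sum (f := fun j => x.2 j ^ 2 / 2 + (scaledChain ω₂ lam β ε).U (x.1 j))
      (fun j _ => hterm j) (Finset.mem_univ i)
  have hU : (scaledChain ω₂ lam β ε).U (x.1 i) = ε * ω₂ * x.1 i ^ 2 / 2 + lam * x.1 i ^ 4 / 4 := rfl
  have hq : 0 ≤ ε * ω₂ * x.1 i ^ 2 / 2 := by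
    have := mul_nonneg hω (sq_nonneg (x.1 i)); linarith
  have hp : 0 ≤ x.2 i ^ 2 / 2 := by positivity
  have hl4 : 0 ≤ lam * x.1 i ^ 4 / 4 := by positivity
  constructor <;> linarith

/-- **A radius for the sublevel sets of `H̃_ε`**: if `H̃_ε(x) ≤ h` (`ε, εω₂, β ≥ 0`, `lam > 0`) then
`‖x‖ ≤ max(√(2h), max(1, 4h/lam))` (`p_i² ≤ 2h`; `q_i⁴ ≤ 4h/lam`, so `|q_i| ≤ 1` or
`|q_i| ≤ |q_i|⁴ ≤ 4h/lam`). [folklore] -/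
theorem scaledChain_norm_le_of_hamiltonian_le (hε : 0 ≤ ε) (hω : 0 ≤ ε * ω₂) (hl : 0 < lam) (hβ : 0 ≤ β)
    (N : ℕ) {x : PhaseSpace N} {h : ℝ} (hx : (scaledChain ω₂ lam β ε).hamiltonian N x ≤ h) :
    ‖x‖ ≤ max (Real.sqrt (2 * h)) (max 1 (4 * h / lam)) := by
  have h0 : 0 ≤ h := (scaledChain_hamiltonian_nonneg ω₂ lam β ε hε hω hl.le hβ N x).trans hx
  rw [Prod.norm_def, max_le_iff]
  constructor
  · refine (pi_norm_le_iff_of_nonneg (by positivity)).2 fun i => le_max_of_le_right ?_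
    have hq := (scaledChain_sq_le_hamiltonian ω₂ lam β ε hε hω hl.le hβ N x i).2.trans hx
    rw [Real.norm_eq_abs]
    rcases le_or_gt |x.1 i| 1 with h1 | h1
    · exact le_max_of_le_left h1
    · refine le_max_of_le_right ?_
      rw [le_div_iff₀ hl]
      have h4 : |x.1 i| ≤ |x.1 i| ^ 4 := by
        calc |x.1 i| = |x.1 i| ^ 1 := (pow_one _).symm
          _ ≤ |x.1 i| ^ 4 := pow_le_pow_right₀ h1.le (by norm_num)
      have habs : |x.1 i| ^ 4 = x.1 i ^ 4 := by
        rw [show (4 : ℕ) = 2 * 2 from rfl, pow_mul, sq_abs, ← pow_mul]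
      nlinarith [habs]
  · refine (pi_norm_le_iff_of_nonneg (by positivity)).2 fun i => ?_
    refine (le_max_left _ _).trans' ?_
    have hp := (scaledChain_sq_le_hamiltonian ω₂ lam β ε hε hω hl.le hβ N x i).1.trans hx
    rw [Real.norm_eq_abs, ← Real.sqrt_sq_eq_abs]
    exact Real.sqrt_le_sqrt (by nlinarith)

end ScaledChain

namespace OscillatorChain

variable (P : OscillatorChain)

/-- **Closed form of the force component**: `∂Φ/∂q_i = U'(q_i) + [0 < i] V'(q_i - q_{i-1}) -
[i+1 < N] V'(q_{i+1} - q_i)` (evaluation of the double sum over bonds in `dPotential`).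
[folklore] -/
theorem dPotential_eq_closed (N : ℕ) (i : Fin N) (q : Fin N → ℝ) :
    P.dPotential N i q = deriv P.U (q i) +
      (if h : 0 < i.val then deriv P.V (q i - q ⟨i.val - 1, by omega⟩) else 0) -
      (if h : i.val + 1 < N then deriv P.V (q ⟨i.val + 1, h⟩ - q i) else 0) := by
  unfold dPotential
  rw [add_sub_assoc]
  congr 1
  -- split the double sum into the `[l = i]` part and the `[k = i]` part
  have hsplit : ∀ k l : Fin N, (if l.val = k.val + 1 then
      deriv P.V (q l - q k) * ((if l = i then 1 else 0) - (if k = i then 1 else 0)) else (0 : ℝ)) =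
      (if l.val = k.val + 1 ∧ l = i then deriv P.V (q l - q k) else 0) -
        (if l.val = k.val + 1 ∧ k = i then deriv P.V (q l - q k) else 0) := by
    intro k l
    by_cases h1 : l.val = k.val + 1
    · by_cases h2 : l = i
      · have h3 : k ≠ i := by
          intro h3; rw [h2, h3] at h1; omega
        simp [h2, h3]
      · by_cases h3 : k = i
        · simp [h1, h2, h3]
        · simp [h1, h2, h3]
    · simp [h1]
  simp_rw [hsplit, Finset.sum_sub_distrib]
  congr 1
  · -- `∑_k ∑_l [l = k+1 ∧ l = i] f(k,l) = [0 < i] f(i-1, i)`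
    rw [Finset.sum_comm]
    rw [Finset.sum_eq_single i (fun l _ hl => by simp [hl]) (by simp)]
    by_cases hi : 0 < i.val
    · rw [dif_pos hi]
      rw [Finset.sum_eq_single (⟨i.val - 1, by omega⟩ : Fin N)]
      · rw [if_pos ⟨by show i.val = (i.val - 1) + 1; omega, rfl⟩]
      · intro k _ hk
        rw [if_neg]
        rintro ⟨h1, -⟩
        apply hk
        ext; simp only; omega
      · simp
    · rw [dif_neg hi]
      refine Finset.sum_eq_zero fun k _ => ?_
      rw [if_neg]
      rintro ⟨h1, -⟩
      omega
  · -- `∑_k ∑_l [l = k+1 ∧ k = i] f(k,l) = [i+1 < N] f(i, i+1)`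
    rw [Finset.sum_eq_single i (fun k _ hk => by simp [hk]) (by simp)]
    by_cases hi : i.val + 1 < N
    · rw [dif_pos hi]
      rw [Finset.sum_eq_single (⟨i.val + 1, hi⟩ : Fin N)]
      · simp
      · intro l _ hl
        rw [if_neg]
        rintro ⟨h1, -⟩
        apply hl
        ext; simp only; omega
      · simp
    · rw [dif_neg hi]
      refine Finset.sum_eq_zero fun l _ => ?_
      rw [if_neg]
      rintro ⟨h1, -⟩
      omega

/-- `DH(y)·Y(y) = -γ ∑_i w_i p_i²` for the Langevin drift without noise; in particular the
Hamiltonian vector field of a chain with `γ = 0` conserves `H`. [folklore] -/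
theorem fderiv_hamiltonian_drift_self (hH : Differentiable ℝ (P.hamiltonian N)) (y : PhaseSpace N) :
    fderiv ℝ (P.hamiltonian N) y (P.drift N y) = -(P.γ * ∑ i, bathWeight N i * y.2 i ^ 2) := by
  rw [P.fderiv_hamiltonian_apply hH]
  simp only [drift]
  rw [Finset.mul_sum, ← Finset.sum_neg_distrib]
  refine Finset.sum_congr rfl fun i _ => ?_
  ring

/-- **The scaling map** `rescale a (q, p) = (a⁻¹ q, a⁻² p)` (CEHR (5.18) with `E = a⁴`,
`ℓ_i = 4`: `q̃ = E^{-1/4} q`, `p̃ = E^{-1/2} p`). [cite: CuneoEckmannHairerReyBellet2018, §5.1 eq. (5.18)] -/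
def rescale (a : ℝ) (z : PhaseSpace N) : PhaseSpace N :=
  (fun i => a⁻¹ * z.1 i, fun i => (a ^ 2)⁻¹ * z.2 i)

/-- Components of the rescaled point. [folklore] -/
@[simp] theorem rescale_fst (a : ℝ) (z : PhaseSpace N) (i : Fin N) : (rescale a z).1 i = a⁻¹ * z.1 i := rfl

/-- Components of the rescaled point. [folklore] -/
@[simp] theorem rescale_snd (a : ℝ) (z : PhaseSpace N) (i : Fin N) : (rescale a z).2 i = (a ^ 2)⁻¹ * z.2 i := rfl

/-- `rescale a` is linear: it commutes with subtraction. [folklore] -/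
theorem rescale_sub (a : ℝ) (z z' : PhaseSpace N) : rescale a (z - z') = rescale a z - rescale a z' := by
  ext i <;> simp [rescale, mul_sub]

/-- `rescale a` is linear: it commutes with addition. [folklore] -/
theorem rescale_add (a : ℝ) (z z' : PhaseSpace N) : rescale a (z + z') = rescale a z + rescale a z' := by
  ext i <;> simp [rescale, mul_add]

/-- `rescale a` is continuous (linear). [folklore] -/
theorem continuous_rescale (a : ℝ) : Continuous (rescale (N := N) a) := by
  unfold rescale
  refine Continuous.prodMk (continuous_pi fun i => ?_) (continuous_pi fun i => ?_)
  · exact continuous_const.mul ((continuous_apply i).comp continuous_fst)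
  · exact continuous_const.mul ((continuous_apply i).comp continuous_snd)

end OscillatorChain

section Scaling

variable (ω₂ lam β γ : ℝ)

/-- **The energy scales like `a⁴`**: `H(z) = a⁴ H̃_{a⁻²}(rescale a z)` for `a ≠ 0` (CEHR (5.23):
"by construction, `H(z) = E H̃(z̃)`"). [cite: CuneoEckmannHairerReyBellet2018, §5.1 eq. (5.23)] -/
theorem pinnedChain_hamiltonian_eq_scaled {a : ℝ} (ha : a ≠ 0) (N : ℕ) (z : PhaseSpace N) :
    (pinnedChain ω₂ lam β γ).hamiltonian N z =
      a ^ 4 * (scaledChain ω₂ lam β (a ^ 2)⁻¹).hamiltonian N (rescale a z) := by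
  unfold OscillatorChain.hamiltonian pinnedChain scaledChain
  simp only [rescale_fst, rescale_snd]
  rw [mul_add, Finset.mul_sum, Finset.mul_sum]
  congr 1
  · refine Finset.sum_congr rfl fun i _ => ?_
    field_simp
  · refine Finset.sum_congr rfl fun i _ => ?_
    rw [Finset.mul_sum]
    refine Finset.sum_congr rfl fun j _ => ?_
    split_ifs
    · field_simp
    · simp

/-- **The force scales like `a³`**: `a⁻³ ∂_{q_i}Φ(q) = ∂_{q̃_i}Φ̃_{a⁻²}(a⁻¹ q)` for `a ≠ 0`
(the computation behind CEHR (5.21): the rescaled drift is `-∇_{q̃} H̃`).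
[cite: CuneoEckmannHairerReyBellet2018, §5.1 eq. (5.21)] -/
theorem pinnedChain_dPotential_eq_scaled {a : ℝ} (ha : a ≠ 0) (N : ℕ) (i : Fin N) (q : Fin N → ℝ) :
    (a ^ 3)⁻¹ * (pinnedChain ω₂ lam β γ).dPotential N i q =
      (scaledChain ω₂ lam β (a ^ 2)⁻¹).dPotential N i (fun j => a⁻¹ * q j) := by
  rw [(pinnedChain ω₂ lam β γ).dPotential_eq_closed, (scaledChain ω₂ lam β (a ^ 2)⁻¹).dPotential_eq_closed]
  simp only [pinnedChain_deriv_U, pinnedChain_deriv_V, scaledChain_deriv_U, scaledChain_deriv_V]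
  have hU : (a ^ 3)⁻¹ * (ω₂ * q i + lam * q i ^ 3) =
      (a ^ 2)⁻¹ * ω₂ * (a⁻¹ * q i) + lam * (a⁻¹ * q i) ^ 3 := by field_simp
  have hV : ∀ r : ℝ, (a ^ 3)⁻¹ * (r + β * r ^ 3) = (a ^ 2)⁻¹ * (a⁻¹ * r) + β * (a⁻¹ * r) ^ 3 := fun r => by
    field_simp
  rw [mul_sub, mul_add, hU]
  congr 2
  · split_ifs
    · rw [hV, mul_sub]
    · simp
  · split_ifs
    · rw [hV, mul_sub]
    · simp

end Scaling

/-! ### The Euler identity for the quartic potential -/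

section Euler

variable (ω₂ lam β : ℝ)

/-- **Euler's identity for the homogeneous quartic potential** `Φ̂(q) = ∑ lam q_i⁴/4 + ∑ β(δq)⁴/4`
(the limiting chain, `ε = 0`): `∑_i q_i ∂Φ̂/∂q_i = 4 Φ̂(q)`. [folklore] -/
theorem scaledChain_zero_euler (N : ℕ) (q : Fin N → ℝ) :
    ∑ i, q i * (scaledChain ω₂ lam β 0).dPotential N i q = 4 * (scaledChain ω₂ lam β 0).potential N q := by
  set P := scaledChain ω₂ lam β 0 with hP
  -- the bond term of `dPotential`, as a function of `(k, l, i)`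
  set T : Fin N → Fin N → Fin N → ℝ := fun k l i =>
    if l.val = k.val + 1 then
      deriv P.V (q l - q k) * ((if l = i then 1 else 0) - (if k = i then 1 else 0)) else 0 with hT
  have hd : ∀ i, P.dPotential N i q = deriv P.U (q i) + ∑ k, ∑ l, T k l i := fun i => rfl
  have hpot : P.potential N q = (∑ i, P.U (q i)) + ∑ k : Fin N, ∑ l : Fin N,
      if l.val = k.val + 1 then P.V (q l - q k) else 0 := rfl
  -- pinning part
  have h1 : ∑ i, q i * deriv P.U (q i) = 4 * ∑ i, P.U (q i) := by
    rw [Finset.mul_sum]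
    refine Finset.sum_congr rfl fun i _ => ?_
    rw [hP, scaledChain_deriv_U]
    show q i * (0 * ω₂ * q i + lam * q i ^ 3) = 4 * (0 * ω₂ * q i ^ 2 / 2 + lam * q i ^ 4 / 4)
    ring
  -- interaction part: `∑_i q_i T(k,l,i) = [l = k+1] V'(q_l - q_k)(q_l - q_k) = 4 [l=k+1] V(q_l - q_k)`
  have hcell : ∀ k l : Fin N, ∑ i, q i * T k l i = 4 * (if l.val = k.val + 1 then P.V (q l - q k) else 0) := by
    intro k l
    by_cases hlk : l.val = k.val + 1
    · have hne : l ≠ k := by intro h; rw [h] at hlk; omega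
      have hterm : ∀ i : Fin N, q i * T k l i =
          (if i = l then q l * deriv P.V (q l - q k) else 0) - (if i = k then q k * deriv P.V (q l - q k) else 0) := by
        intro i
        simp only [hT, hlk, if_true]
        by_cases h1 : i = l
        · subst h1
          simp [hne, Ne.symm hne]
        · by_cases h2 : i = k
          · subst h2
            simp [h1, hne]
          · have h1' : ¬ l = i := fun h => h1 h.symm
            have h2' : ¬ k = i := fun h => h2 h.symm
            simp [h1, h2, h1', h2']
      simp_rw [hterm, Finset.sum_sub_distrib, Finset.sum_ite_eq', Finset.mem_univ, if_true, if_pos hlk]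
      rw [hP, scaledChain_deriv_V]
      show q l * (0 * (q l - q k) + β * (q l - q k) ^ 3) - q k * (0 * (q l - q k) + β * (q l - q k) ^ 3) =
        4 * (0 * (q l - q k) ^ 2 / 2 + β * (q l - q k) ^ 4 / 4)
      ring
    · have : ∀ i, q i * T k l i = 0 := fun i => by simp [hT, hlk]
      simp [this, hlk]
  have h2 : ∑ i, q i * ∑ k, ∑ l, T k l i = 4 * ∑ k : Fin N, ∑ l : Fin N,
      if l.val = k.val + 1 then P.V (q l - q k) else 0 := by
    calc ∑ i, q i * ∑ k, ∑ l, T k l i = ∑ i, ∑ k, ∑ l, q i * T k l i := by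
          refine Finset.sum_congr rfl fun i _ => ?_
          rw [Finset.mul_sum]
          exact Finset.sum_congr rfl fun k _ => Finset.mul_sum _ _ _
      _ = ∑ k, ∑ l, ∑ i, q i * T k l i := by
          rw [Finset.sum_comm]
          exact Finset.sum_congr rfl fun k _ => Finset.sum_comm
      _ = ∑ k, ∑ l, 4 * (if l.val = k.val + 1 then P.V (q l - q k) else 0) :=
          Finset.sum_congr rfl fun k _ => Finset.sum_congr rfl fun l _ => hcell k l
      _ = 4 * ∑ k : Fin N, ∑ l : Fin N, if l.val = k.val + 1 then P.V (q l - q k) else 0 := by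
          rw [Finset.mul_sum]
          exact Finset.sum_congr rfl fun k _ => (Finset.mul_sum _ _ _).symm
  calc ∑ i, q i * P.dPotential N i q = ∑ i, (q i * deriv P.U (q i) + q i * ∑ k, ∑ l, T k l i) :=
        Finset.sum_congr rfl fun i _ => by rw [hd i, mul_add]
    _ = 4 * ∑ i, P.U (q i) + 4 * ∑ k : Fin N, ∑ l : Fin N, (if l.val = k.val + 1 then P.V (q l - q k) else 0) := by
        rw [Finset.sum_add_distrib, h1, h2]
    _ = 4 * P.potential N q := by rw [hpot, mul_add]

/-- For the limiting chain, `H = ∑ p²/2 + Φ̂` with `Φ̂ ≥ 0`; if all forces vanish and all momenta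
vanish then `Ĥ = 0` (Euler). [folklore] -/
theorem scaledChain_zero_hamiltonian_eq_zero (N : ℕ) (x : PhaseSpace N) (hp : ∀ i, x.2 i = 0)
    (hF : ∀ i, (scaledChain ω₂ lam β 0).dPotential N i x.1 = 0) :
    (scaledChain ω₂ lam β 0).hamiltonian N x = 0 := by
  rw [(scaledChain ω₂ lam β 0).hamiltonian_eq_kinetic_add_potential]
  have h1 : ∑ i, x.2 i ^ 2 / 2 = 0 := Finset.sum_eq_zero fun i _ => by simp [hp i]
  have h2 := scaledChain_zero_euler ω₂ lam β N x.1
  have h3 : ∑ i, x.1 i * (scaledChain ω₂ lam β 0).dPotential N i x.1 = 0 :=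
    Finset.sum_eq_zero fun i _ => by simp [hF i]
  rw [h1, zero_add]
  linarith

end Euler

/-! ### The flow of the limiting quartic system (CEHR (5.32)) -/

section LimitFlow

variable (ω₂ lam β : ℝ)

/-- A radius for the sublevel set `{Ĥ ≤ 4}` of the limiting chain (`lam > 0`), plus one:
`max(√8, 1, 16/lam) + 1`. [folklore] -/
def limitRadius (lam : ℝ) : ℝ := max (Real.sqrt (2 * 4)) (max 1 (4 * 4 / lam)) + 1

/-- The truncation radius is positive. [folklore] -/
theorem limitRadius_pos : 0 < limitRadius lam := by
  unfold limitRadius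
  have : (0 : ℝ) ≤ max (Real.sqrt (2 * 4)) (max 1 (4 * 4 / lam)) := le_max_of_le_left (Real.sqrt_nonneg _)
  linarith

/-- **The flow of the limiting system** (CEHR (5.32): `dq̂ = p̂ dσ`, `dp̂ = -∇Ĥ dσ`, no friction term
since `ℓ_i = 4 ≠ 2`): the Picard solution of the quartic chain `scaledChain ω₂ lam β 0` with ZERO
noise and the drift truncated outside the ball of radius `2 · limitRadius` (a transparent device:
for `Ĥ(x) ≤ 4` the solution never leaves the ball of radius `limitRadius - 1`, by conservation of
`Ĥ`, so it solves the untruncated equation, `limitFlow_eq_integral`).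
[cite: CuneoEckmannHairerReyBellet2018, §5.1 eq. (5.32)] -/
def limitFlow (N : ℕ) (x : PhaseSpace N) : ℝ → PhaseSpace N :=
  (scaledChain ω₂ lam β 0).truncSol N (limitRadius lam) x 0

/-- A Lipschitz constant of the truncated limiting field exists. [folklore] -/
theorem exists_lipschitzWith_limitField (N : ℕ) :
    ∃ K : ℝ≥0, LipschitzWith K (truncateField (limitRadius lam) ((scaledChain ω₂ lam β 0).drift N)) :=
  exists_lipschitzWith_truncateField (scaledChain_contDiff_drift ω₂ lam β 0 N (n := 1)) (limitRadius_pos lam)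

/-- The forcing of the noiseless equation is the constant `x`. [folklore] -/
theorem forcing_zero_noise (N : ℕ) (x : PhaseSpace N) : forcing x (0 : ℝ → Fin N → ℝ) = fun _ => x := by
  funext t
  simp only [forcing, Pi.zero_apply]
  rw [show ((0 : Fin N → ℝ), (0 : Fin N → ℝ)) = (0 : PhaseSpace N) from rfl, add_zero]

/-- The limiting flow is continuous in time. [folklore] -/
theorem continuous_limitFlow (N : ℕ) (x : PhaseSpace N) : Continuous (limitFlow ω₂ lam β N x) := by
  obtain ⟨K, hK⟩ := exists_lipschitzWith_limitField ω₂ lam β N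
  exact continuous_forcedSolution hK (continuous_forcing x continuous_zero)

/-- **The truncated integral equation**: `ψ(σ) = x + ∫₀^σ Y_R(ψ(u)) du` for `σ ≥ 0`. [folklore] -/
theorem limitFlow_eq_integral_trunc (N : ℕ) (x : PhaseSpace N) {σ : ℝ} (hσ : 0 ≤ σ) :
    limitFlow ω₂ lam β N x σ = x + ∫ u in (0 : ℝ)..σ,
      truncateField (limitRadius lam) ((scaledChain ω₂ lam β 0).drift N) (limitFlow ω₂ lam β N x u) := by
  obtain ⟨K, hK⟩ := exists_lipschitzWith_limitField ω₂ lam β N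
  have h := forcedSolution_eq hK (continuous_forcing x (continuous_zero : Continuous (0 : ℝ → Fin N → ℝ))) hσ
  have h0 : forcing x (0 : ℝ → Fin N → ℝ) σ = x := by
    simp only [forcing, Pi.zero_apply]
    exact add_zero x
  unfold limitFlow OscillatorChain.truncSol
  rw [h, h0]

/-- `ψ(0) = x`. [folklore] -/
theorem limitFlow_zero (N : ℕ) (x : PhaseSpace N) : limitFlow ω₂ lam β N x 0 = x := by
  rw [limitFlow_eq_integral_trunc ω₂ lam β N x le_rfl]
  simp

/-- The **everywhere-differentiable extension** `ψ̄(σ) = x + ∫₀^σ Y_R(ψ(u)) du` of the limiting flow: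
it coincides with `ψ` on `[0, ∞)` (`limitFlowExt_eq`) and is differentiable on all of `ℝ`, which is
convenient at `σ = 0`. [folklore] -/
def limitFlowExt (N : ℕ) (x : PhaseSpace N) (σ : ℝ) : PhaseSpace N :=
  x + ∫ u in (0 : ℝ)..σ, truncateField (limitRadius lam) ((scaledChain ω₂ lam β 0).drift N) (limitFlow ω₂ lam β N x u)

/-- `ψ̄ = ψ` on `[0, ∞)`. [folklore] -/
theorem limitFlowExt_eq (N : ℕ) (x : PhaseSpace N) {σ : ℝ} (hσ : 0 ≤ σ) :
    limitFlowExt ω₂ lam β N x σ = limitFlow ω₂ lam β N x σ :=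
  (limitFlow_eq_integral_trunc ω₂ lam β N x hσ).symm

/-- `ψ̄' = Y_R(ψ)` everywhere. [folklore] -/
theorem hasDerivAt_limitFlowExt_trunc (N : ℕ) (x : PhaseSpace N) (σ : ℝ) :
    HasDerivAt (limitFlowExt ω₂ lam β N x)
      (truncateField (limitRadius lam) ((scaledChain ω₂ lam β 0).drift N) (limitFlow ω₂ lam β N x σ)) σ := by
  obtain ⟨K, hK⟩ := exists_lipschitzWith_limitField ω₂ lam β N
  have hc : Continuous fun u => truncateField (limitRadius lam) ((scaledChain ω₂ lam β 0).drift N)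
      (limitFlow ω₂ lam β N x u) := hK.continuous.comp (continuous_limitFlow ω₂ lam β N x)
  exact (hc.integral_hasStrictDerivAt 0 σ).hasDerivAt.const_add x

/-- `ψ̄` is continuous. [folklore] -/
theorem continuous_limitFlowExt (N : ℕ) (x : PhaseSpace N) : Continuous (limitFlowExt ω₂ lam β N x) :=
  continuous_iff_continuousAt.2 fun σ => (hasDerivAt_limitFlowExt_trunc ω₂ lam β N x σ).continuousAt

/-- **Conservation of the limiting energy**: `Ĥ(ψ(σ)) = Ĥ(x)` for `σ ≥ 0` (the truncated field is a
scalar multiple of the Hamiltonian field, along which `Ĥ` is constant: `DĤ·X_Ĥ = 0`).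
[cite: CuneoEckmannHairerReyBellet2018, §5.1 (proof of Lemma 5.17: "`d/dσ Ĥ(ẑ_σ) = -δ_{ℓ_i,2}∑γ_b p̂_b² ≤ 0`")] -/
theorem hamiltonian_limitFlow (N : ℕ) (x : PhaseSpace N) {σ : ℝ} (hσ : 0 ≤ σ) :
    (scaledChain ω₂ lam β 0).hamiltonian N (limitFlow ω₂ lam β N x σ) =
      (scaledChain ω₂ lam β 0).hamiltonian N x := by
  set P := scaledChain ω₂ lam β 0 with hP
  have hHd : Differentiable ℝ (P.hamiltonian N) :=
    (scaledChain_contDiff_hamiltonian ω₂ lam β 0 N (n := 1)).differentiable one_ne_zero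
  -- `Ĥ ∘ ψ̄` has zero derivative everywhere on `[0, ∞)`
  set g : ℝ → ℝ := fun u => P.hamiltonian N (limitFlowExt ω₂ lam β N x u) with hg
  have hderiv : ∀ u, 0 ≤ u → HasDerivAt g 0 u := by
    intro u hu
    have h := (hHd _).hasFDerivAt.comp_hasDerivAt u (hasDerivAt_limitFlowExt_trunc ω₂ lam β N x u)
    have hzero : fderiv ℝ (P.hamiltonian N) (limitFlowExt ω₂ lam β N x u)
        (truncateField (limitRadius lam) (P.drift N) (limitFlow ω₂ lam β N x u)) = 0 := by
      rw [limitFlowExt_eq ω₂ lam β N x hu, truncateField, map_smul, P.fderiv_hamiltonian_drift_self hHd]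
      simp [hP]
    rw [hzero] at h
    exact h
  have hHc : Continuous (P.hamiltonian N) := P.continuous_hamiltonian
    (scaledChain_contDiff_U ω₂ lam β 0 (n := 0)).continuous (scaledChain_contDiff_V ω₂ lam β 0 (n := 0)).continuous N
  have hgc : Continuous g := hHc.comp (continuous_limitFlowExt ω₂ lam β N x)
  have hconst := constant_of_has_deriv_right_zero hgc.continuousOn
    (fun u hu => (hderiv u hu.1).hasDerivWithinAt) σ ⟨hσ, le_rfl⟩
  simp only [hg] at hconst
  rwa [limitFlowExt_eq ω₂ lam β N x hσ, limitFlowExt_eq ω₂ lam β N x le_rfl, limitFlow_zero] at hconst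

variable {lam}

/-- **The limiting flow stays in the ball**: for `Ĥ(x) ≤ 4` (`lam > 0`, `β ≥ 0`) and `σ ≥ 0`,
`‖ψ(σ)‖ ≤ limitRadius - 1`. [folklore] -/
theorem norm_limitFlow_le (hl : 0 < lam) (hβ : 0 ≤ β) (N : ℕ) {x : PhaseSpace N}
    (hx : (scaledChain ω₂ lam β 0).hamiltonian N x ≤ 4) {σ : ℝ} (hσ : 0 ≤ σ) :
    ‖limitFlow ω₂ lam β N x σ‖ ≤ limitRadius lam - 1 := by
  have h := hamiltonian_limitFlow ω₂ lam β N x hσ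
  have hb := scaledChain_norm_le_of_hamiltonian_le ω₂ lam β 0 le_rfl (by rw [zero_mul]) hl hβ N
    (x := limitFlow ω₂ lam β N x σ) (h := 4) (by rw [h]; exact hx)
  unfold limitRadius
  linarith [hb]

/-- For `Ĥ(x) ≤ 4` the truncation is invisible along the flow. [folklore] -/
theorem truncateField_limitFlow (hl : 0 < lam) (hβ : 0 ≤ β) (N : ℕ) {x : PhaseSpace N}
    (hx : (scaledChain ω₂ lam β 0).hamiltonian N x ≤ 4) {σ : ℝ} (hσ : 0 ≤ σ) :
    truncateField (limitRadius lam) ((scaledChain ω₂ lam β 0).drift N) (limitFlow ω₂ lam β N x σ) =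
      (scaledChain ω₂ lam β 0).drift N (limitFlow ω₂ lam β N x σ) :=
  truncateField_of_norm_le (limitRadius_pos lam) _ (by linarith [norm_limitFlow_le ω₂ β hl hβ N hx hσ])

/-- **The limiting flow solves (5.32)**: `ψ(σ) = x + ∫₀^σ X_Ĥ(ψ(u)) du` for `σ ≥ 0`, `Ĥ(x) ≤ 4`.
[cite: CuneoEckmannHairerReyBellet2018, §5.1 eq. (5.32)] -/
theorem limitFlow_eq_integral (hl : 0 < lam) (hβ : 0 ≤ β) (N : ℕ) {x : PhaseSpace N}
    (hx : (scaledChain ω₂ lam β 0).hamiltonian N x ≤ 4) {σ : ℝ} (hσ : 0 ≤ σ) :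
    limitFlow ω₂ lam β N x σ = x + ∫ u in (0 : ℝ)..σ, (scaledChain ω₂ lam β 0).drift N (limitFlow ω₂ lam β N x u) := by
  rw [limitFlow_eq_integral_trunc ω₂ lam β N x hσ]
  congr 1
  refine intervalIntegral.integral_congr fun u hu => ?_
  rw [uIcc_of_le hσ] at hu
  exact truncateField_limitFlow ω₂ β hl hβ N hx hu.1

/-- **The derivative of the (extended) limiting flow is the Hamiltonian field**, for `σ ≥ 0` and
`Ĥ(x) ≤ 4`: `q̂' = p̂`, `p̂' = -∇Φ̂(q̂)`. [cite: CuneoEckmannHairerReyBellet2018, §5.1 eq. (5.32)] -/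
theorem hasDerivAt_limitFlowExt (hl : 0 < lam) (hβ : 0 ≤ β) (N : ℕ) {x : PhaseSpace N}
    (hx : (scaledChain ω₂ lam β 0).hamiltonian N x ≤ 4) {σ : ℝ} (hσ : 0 ≤ σ) :
    HasDerivAt (limitFlowExt ω₂ lam β N x)
      ((limitFlow ω₂ lam β N x σ).2, fun i => -(scaledChain ω₂ lam β 0).dPotential N i (limitFlow ω₂ lam β N x σ).1) σ := by
  have h := hasDerivAt_limitFlowExt_trunc ω₂ lam β N x σ
  rwa [truncateField_limitFlow ω₂ β hl hβ N hx hσ, scaledChain_drift_apply] at h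

variable (lam)

/-- **Lipschitz dependence on the initial condition** (Grönwall for the common truncated field):
`‖ψ_x(σ) - ψ_{x'}(σ)‖ ≤ ‖x - x'‖ e^{K σ}` on `[0, T]`, for ALL `x, x'`. [folklore] -/
theorem exists_norm_limitFlow_sub_le (N : ℕ) :
    ∃ K : ℝ≥0, ∀ (x x' : PhaseSpace N) {σ : ℝ}, 0 ≤ σ →
      ‖limitFlow ω₂ lam β N x σ - limitFlow ω₂ lam β N x' σ‖ ≤ ‖x - x'‖ * Real.exp (K * σ) := by
  obtain ⟨K, hK⟩ := exists_lipschitzWith_limitField ω₂ lam β N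
  refine ⟨K, fun x x' σ hσ => ?_⟩
  have h := norm_forcedSolution_sub_le hK (continuous_forcing x (continuous_zero : Continuous (0 : ℝ → Fin N → ℝ)))
    (continuous_forcing x' (continuous_zero : Continuous (0 : ℝ → Fin N → ℝ))) (T := σ) (δ := ‖x - x'‖)
    (fun t _ => by rw [forcing_sub_forcing]) σ ⟨hσ, le_rfl⟩
  exact h

/-- **Joint continuity of the limiting flow in `(x, σ)`** (continuous in `σ`, Lipschitz in `x`
locally uniformly in `σ`). [folklore] -/
theorem continuous_limitFlow_uncurry (N : ℕ) :
    Continuous fun p : PhaseSpace N × ℝ => limitFlow ω₂ lam β N p.1 p.2 := by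
  obtain ⟨K, hK⟩ := exists_norm_limitFlow_sub_le ω₂ lam β N
  -- on each strip `univ × (-∞, T)` the flow is Lipschitz in `x` with constant `e^{K max(T,0)}`
  have hstrip : ∀ T : ℝ, ContinuousOn (fun p : PhaseSpace N × ℝ => limitFlow ω₂ lam β N p.1 p.2)
      (univ ×ˢ Iio T) := by
    intro T
    refine continuousOn_prod_of_continuousOn_lipschitzOnWith _ (Real.exp (K * max T 0)).toNNReal
      (fun x _ => (continuous_limitFlow ω₂ lam β N x).continuousOn) fun σ hσ => ?_
    refine LipschitzOnWith.of_dist_le_mul fun x _ x' _ => ?_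
    dsimp only
    rw [dist_eq_norm, dist_eq_norm, Real.coe_toNNReal _ (Real.exp_pos _).le]
    rcases le_or_gt 0 σ with h0 | h0
    · refine (hK x x' h0).trans ?_
      rw [mul_comm]
      refine mul_le_mul_of_nonneg_right (Real.exp_le_exp.2 ?_) (norm_nonneg _)
      exact mul_le_mul_of_nonneg_left ((le_max_left _ _).trans' (le_of_lt hσ)) K.coe_nonneg
    · -- for `σ < 0` the flow is clamped at its value at `0`, i.e. at `x`
      have hc : ∀ y : PhaseSpace N, limitFlow ω₂ lam β N y σ = y := fun y => by
        unfold limitFlow OscillatorChain.truncSol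
        rw [forcedSolution_of_nonpos _ _ h0.le]
        have := limitFlow_zero ω₂ lam β N y
        unfold limitFlow OscillatorChain.truncSol at this
        exact this
      rw [hc, hc]
      have : (1 : ℝ) ≤ Real.exp (K * max T 0) := Real.one_le_exp (by positivity)
      nlinarith [norm_nonneg (x - x')]
  refine continuous_iff_continuousAt.2 fun p => ?_
  exact (hstrip (p.2 + 1)).continuousAt
    ((isOpen_univ.prod isOpen_Iio).mem_nhds ⟨mem_univ _, by simp⟩)

/-- The dissipation of the limiting flow at the first bath site over `[0, Λ]`,
`D(x) = ∫₀^Λ p̂_0(σ)² dσ`, is continuous in the initial condition. [folklore] -/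
theorem continuous_dissipation_limitFlow (N : ℕ) (i : Fin N) (Λ : ℝ) :
    Continuous fun x : PhaseSpace N => ∫ σ in (0 : ℝ)..Λ, (limitFlow ω₂ lam β N x σ).2 i ^ 2 := by
  have hc : Continuous fun p : PhaseSpace N × ℝ => (limitFlow ω₂ lam β N p.1 p.2).2 i ^ 2 :=
    ((continuous_apply i).comp (continuous_snd.comp (continuous_limitFlow_uncurry ω₂ lam β N))).pow 2
  exact intervalIntegral.continuous_parametric_intervalIntegral_of_continuous' hc 0 Λ

end LimitFlow

/-! ### CEHR Proposition 5.14: the limiting system dissipates -/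

section Dissipation

/-- A continuous function equal to a constant on `(a, b)` (`a < b`) equals it on `[a, b]`. [folklore] -/
theorem eq_on_Icc_of_eq_on_Ioo {f : ℝ → ℝ} (hf : Continuous f) {a b c : ℝ} (hab : a < b)
    (h : ∀ x ∈ Ioo a b, f x = c) : ∀ x ∈ Icc a b, f x = c := by
  have hcl : IsClosed {x | f x = c} := isClosed_eq hf continuous_const
  have hsub : Ioo a b ⊆ {x | f x = c} := fun x hx => h x hx
  have := hcl.closure_subset_iff.2 hsub
  rw [closure_Ioo hab.ne] at this
  exact fun x hx => this hx

/-- If a continuous nonnegative function has zero integral over `[0, Λ]` then it vanishes on `[0, Λ]`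
(the primitive is monotone with equal endpoints, hence constant, hence has zero derivative).
[folklore] -/
theorem eq_zero_of_integral_eq_zero {f : ℝ → ℝ} (hf : Continuous f) (hnn : ∀ x, 0 ≤ f x) {Λ : ℝ}
    (hΛ : 0 < Λ) (h0 : ∫ x in (0 : ℝ)..Λ, f x = 0) : ∀ x ∈ Icc 0 Λ, f x = 0 := by
  set F : ℝ → ℝ := fun s => ∫ x in (0 : ℝ)..s, f x with hF
  have hFd : ∀ s, HasDerivAt F (f s) s := fun s => (hf.integral_hasStrictDerivAt 0 s).hasDerivAt
  have hF0 : ∀ s ∈ Icc 0 Λ, F s = 0 := by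
    intro s hs
    have h1 : 0 ≤ F s := intervalIntegral.integral_nonneg hs.1 fun x _ => hnn x
    have h2 : 0 ≤ ∫ x in s..Λ, f x := intervalIntegral.integral_nonneg hs.2 fun x _ => hnn x
    have h3 : F s + ∫ x in s..Λ, f x = 0 := by
      rw [hF, intervalIntegral.integral_add_adjacent_intervals (hf.intervalIntegrable _ _)
        (hf.intervalIntegrable _ _), h0]
    linarith
  have hIoo : ∀ s ∈ Ioo 0 Λ, f s = 0 := by
    intro s hs
    have hev : F =ᶠ[𝓝 s] fun _ => 0 := by
      filter_upwards [Ioo_mem_nhds hs.1 hs.2] with u hu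
      exact hF0 u ⟨hu.1.le, hu.2.le⟩
    have h1 : HasDerivAt F 0 s := (hasDerivAt_const s (0 : ℝ)).congr_of_eventuallyEq hev
    exact (hFd s).unique h1
  exact eq_on_Icc_of_eq_on_Ioo hf hΛ hIoo

variable (ω₂ : ℝ) {lam β : ℝ} (hl : 0 < lam) (hβ : 0 < β)
include hl hβ

open scoped ContDiff in
/-- **Positivity of the dissipation of the limiting system** (CEHR (5.34), proof of Prop. 5.14, for
the pinned chain; the bath site is `0`): if `0 < Ĥ(x) ≤ 4` then `∫₀^Λ p̂_0(σ)² dσ > 0` for every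
`Λ > 0`. Printed argument: if `p̂_0 ≡ 0` on `[0, Λ]` then `q̂_0` is constant, the total force on site
`0` vanishes, so `∇V_∞(q̂_1 - q̂_0) = β(q̂_1 - q̂_0)³` is constant and (C4: injectivity of `r ↦ βr³`)
`q̂_1` is constant, hence `p̂_1 ≡ 0`; inductively no mass moves on `[0, Λ]`, all forces vanish at
`σ = 0`, and Euler's identity gives `Ĥ(x) = 0`.
[cite: CuneoEckmannHairerReyBellet2018, Prop 5.14 (proof, eq. (5.34)) and Remark 5.15] -/
theorem dissipation_limitFlow_pos {N : ℕ} (hN : 0 < N) {Λ : ℝ} (hΛ : 0 < Λ) {x : PhaseSpace N}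
    (hx4 : (scaledChain ω₂ lam β 0).hamiltonian N x ≤ 4) (hx0 : 0 < (scaledChain ω₂ lam β 0).hamiltonian N x) :
    0 < ∫ σ in (0 : ℝ)..Λ, (limitFlow ω₂ lam β N x σ).2 ⟨0, hN⟩ ^ 2 := by
  set P := scaledChain ω₂ lam β 0 with hP
  set ψ := limitFlowExt ω₂ lam β N x with hψ
  -- the extended flow agrees with the flow on `[0, ∞)`, starts at `x`, and solves (5.32)
  have hψeq : ∀ {σ : ℝ}, 0 ≤ σ → limitFlow ω₂ lam β N x σ = ψ σ := fun hσ =>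
    (limitFlowExt_eq ω₂ lam β N x hσ).symm
  have hψ0 : ψ 0 = x := by rw [← hψeq le_rfl, limitFlow_zero]
  have hψc : Continuous ψ := continuous_limitFlowExt ω₂ lam β N x
  have hderiv : ∀ {σ : ℝ}, 0 ≤ σ → HasDerivAt ψ ((ψ σ).2, fun i => -P.dPotential N i (ψ σ).1) σ := by
    intro σ hσ
    have h := hasDerivAt_limitFlowExt ω₂ β hl hβ.le N hx4 hσ
    rwa [hψeq hσ] at h
  have hq : ∀ (i : Fin N) {σ : ℝ}, 0 ≤ σ → HasDerivAt (fun s => (ψ s).1 i) ((ψ σ).2 i) σ := by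
    intro i σ hσ
    have h := ((ContinuousLinearMap.proj i : (Fin N → ℝ) →L[ℝ] ℝ).comp
      (ContinuousLinearMap.fst ℝ (Fin N → ℝ) (Fin N → ℝ))).hasFDerivAt.comp_hasDerivAt σ (hderiv hσ)
    exact h
  have hp : ∀ (i : Fin N) {σ : ℝ}, 0 ≤ σ → HasDerivAt (fun s => (ψ s).2 i) (-P.dPotential N i (ψ σ).1) σ := by
    intro i σ hσ
    have h := ((ContinuousLinearMap.proj i : (Fin N → ℝ) →L[ℝ] ℝ).comp
      (ContinuousLinearMap.snd ℝ (Fin N → ℝ) (Fin N → ℝ))).hasFDerivAt.comp_hasDerivAt σ (hderiv hσ)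
    exact h
  have hqc : ∀ i, Continuous fun s => (ψ s).1 i := fun i => (continuous_apply i).comp (continuous_fst.comp hψc)
  have hpc : ∀ i, Continuous fun s => (ψ s).2 i := fun i => (continuous_apply i).comp (continuous_snd.comp hψc)
  have hFc : ∀ i, Continuous fun s => P.dPotential N i (ψ s).1 := fun i =>
    (P.contDiff_dPotential (scaledChain_contDiff_U ω₂ lam β 0) (scaledChain_contDiff_V ω₂ lam β 0) N i).continuous.comp
      (continuous_fst.comp hψc)
  -- (a) a vanishing momentum forces a vanishing force: `p_j ≡ 0 ⟹ ∂_jΦ̂(q) ≡ 0` on `[0, Λ]`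
  have hforce : ∀ j : Fin N, (∀ σ ∈ Icc 0 Λ, (ψ σ).2 j = 0) → ∀ σ ∈ Icc 0 Λ, P.dPotential N j (ψ σ).1 = 0 := by
    intro j hj
    refine eq_on_Icc_of_eq_on_Ioo (hFc j) hΛ fun σ hσ => ?_
    have hev : (fun s => (ψ s).2 j) =ᶠ[𝓝 σ] fun _ => 0 := by
      filter_upwards [Ioo_mem_nhds hσ.1 hσ.2] with u hu
      exact hj u ⟨hu.1.le, hu.2.le⟩
    have h1 : HasDerivAt (fun s => (ψ s).2 j) 0 σ := (hasDerivAt_const σ (0 : ℝ)).congr_of_eventuallyEq hev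
    have h2 := (hp j hσ.1.le).unique h1
    linarith
  -- (b) a constant position forces a vanishing momentum: `q_j ≡ c ⟹ p_j ≡ 0` on `[0, Λ]`
  have hstill : ∀ j : Fin N, (∀ σ ∈ Icc 0 Λ, (ψ σ).1 j = x.1 j) → ∀ σ ∈ Icc 0 Λ, (ψ σ).2 j = 0 := by
    intro j hj
    refine eq_on_Icc_of_eq_on_Ioo (hpc j) hΛ fun σ hσ => ?_
    have hev : (fun s => (ψ s).1 j) =ᶠ[𝓝 σ] fun _ => x.1 j := by
      filter_upwards [Ioo_mem_nhds hσ.1 hσ.2] with u hu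
      exact hj u ⟨hu.1.le, hu.2.le⟩
    have h1 : HasDerivAt (fun s => (ψ s).1 j) 0 σ := (hasDerivAt_const σ (x.1 j)).congr_of_eventuallyEq hev
    exact (hq j hσ.1.le).unique h1
  -- (c) a vanishing momentum forces a constant position: `p_j ≡ 0 ⟹ q_j ≡ q_j(0)` on `[0, Λ]`
  have hconst : ∀ j : Fin N, (∀ σ ∈ Icc 0 Λ, (ψ σ).2 j = 0) → ∀ σ ∈ Icc 0 Λ, (ψ σ).1 j = x.1 j := by
    intro j hj σ hσ
    have h := constant_of_has_deriv_right_zero (hqc j).continuousOn (fun u hu => ?_) σ hσ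
    · rw [h]; simp [hψ0]
    · have hd := hq j hu.1
      rw [hj u ⟨hu.1, hu.2.le⟩] at hd
      exact hd.hasDerivWithinAt
  -- Step 0: `∫₀^Λ p_0² = 0` forces `p_0 ≡ 0`
  by_contra hD
  have hD0 : ∫ σ in (0 : ℝ)..Λ, (ψ σ).2 ⟨0, hN⟩ ^ 2 = 0 := by
    have hnn : 0 ≤ ∫ σ in (0 : ℝ)..Λ, (limitFlow ω₂ lam β N x σ).2 ⟨0, hN⟩ ^ 2 :=
      intervalIntegral.integral_nonneg hΛ.le fun σ _ => sq_nonneg _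
    have heq : ∫ σ in (0 : ℝ)..Λ, (limitFlow ω₂ lam β N x σ).2 ⟨0, hN⟩ ^ 2 = ∫ σ in (0 : ℝ)..Λ, (ψ σ).2 ⟨0, hN⟩ ^ 2 := by
      refine intervalIntegral.integral_congr fun σ hσ => ?_
      rw [uIcc_of_le hΛ.le] at hσ
      simp only [hψeq hσ.1]
    rw [← heq]
    linarith [not_lt.1 hD]
  have hp0 : ∀ σ ∈ Icc 0 Λ, (ψ σ).2 ⟨0, hN⟩ = 0 := by
    have h := eq_zero_of_integral_eq_zero ((hpc ⟨0, hN⟩).pow 2) (fun σ => sq_nonneg _) hΛ hD0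
    intro σ hσ
    exact pow_eq_zero_iff two_ne_zero |>.1 (h σ hσ)
  -- propagation along the chain
  have hprop : ∀ k : ℕ, ∀ i : Fin N, i.val ≤ k →
      (∀ σ ∈ Icc 0 Λ, (ψ σ).2 i = 0) ∧ (∀ σ ∈ Icc 0 Λ, (ψ σ).1 i = x.1 i) := by
    intro k
    induction k with
    | zero =>
      intro i hi
      have hi0 : i = ⟨0, hN⟩ := Fin.ext (by simpa using hi)
      subst hi0
      exact ⟨hp0, hconst _ hp0⟩
    | succ k ih =>
      intro i hi
      rcases Nat.lt_or_ge i.val (k + 1) with hlt | hge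
      · exact ih i (by omega)
      · have hik : i.val = k + 1 := le_antisymm hi hge
        -- the previous site `j = k`, with `j + 1 = i`
        have hkN : k < N := by omega
        set j : Fin N := ⟨k, hkN⟩ with hj
        obtain ⟨hpj, hqj⟩ := ih j le_rfl
        have hFj := hforce j hpj
        -- the force on `j`: `lam q_j³ + [0<k] β(q_j - q_{j-1})³ - β(q_i - q_j)³ = 0`
        have hcube : ∀ σ ∈ Icc 0 Λ, β * ((ψ σ).1 i - x.1 j) ^ 3 = β * (x.1 i - x.1 j) ^ 3 := by
          intro σ hσ
          have h1 := hFj σ hσ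
          have h0 := hFj 0 ⟨le_rfl, hΛ.le⟩
          rw [P.dPotential_eq_closed] at h1 h0
          have hi' : (⟨j.val + 1, by simp [hj]; omega⟩ : Fin N) = i := Fin.ext (by simp [hj, hik])
          simp only [dif_pos (show j.val + 1 < N by simp [hj]; omega), hi'] at h1 h0
          rw [hψ0] at h0
          rw [hqj σ hσ] at h1
          -- the `[0 < j]` term is the same constant at `σ` and at `0`
          have hprev : (if h : 0 < j.val then deriv P.V (x.1 j - (ψ σ).1 ⟨j.val - 1, by omega⟩) else 0) =
              (if h : 0 < j.val then deriv P.V (x.1 j - x.1 ⟨j.val - 1, by omega⟩) else 0) := by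
            by_cases h0j : 0 < j.val
            · rw [dif_pos h0j, dif_pos h0j]
              have := (ih ⟨j.val - 1, by omega⟩ (by simp [hj])).2 σ hσ
              rw [this]
            · rw [dif_neg h0j, dif_neg h0j]
          rw [hprev] at h1
          simp only [hP, scaledChain_deriv_V, zero_mul, zero_add] at h1 h0
          linarith
        have hqi : ∀ σ ∈ Icc 0 Λ, (ψ σ).1 i = x.1 i := by
          intro σ hσ
          have h := hcube σ hσ
          have h3 : ((ψ σ).1 i - x.1 j) ^ 3 = (x.1 i - x.1 j) ^ 3 := mul_left_cancel₀ hβ.ne' h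
          have hinj := (Odd.strictMono_pow (by decide : Odd 3) : StrictMono fun a : ℝ => a ^ 3).injective h3
          linarith
        exact ⟨hstill i hqi, hqi⟩
  -- all momenta and all forces vanish at `σ = 0`, so `Ĥ(x) = 0`
  have hall : ∀ i : Fin N, (∀ σ ∈ Icc 0 Λ, (ψ σ).2 i = 0) := fun i => (hprop i.val i le_rfl).1
  have hmom : ∀ i : Fin N, x.2 i = 0 := fun i => by
    have := hall i 0 ⟨le_rfl, hΛ.le⟩; rwa [hψ0] at this
  have hfor : ∀ i : Fin N, P.dPotential N i x.1 = 0 := fun i => by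
    have := hforce i (hall i) 0 ⟨le_rfl, hΛ.le⟩; rwa [hψ0] at this
  have := scaledChain_zero_hamiltonian_eq_zero ω₂ lam β N x hmom hfor
  linarith

/-- **CEHR Proposition 5.14 for the pinned chain** (`lam, β > 0`, the case `ℓ_i = ℓ_p`): there is
`C > 0` such that for every initial condition `ẑ₀` with `Ĥ(ẑ₀) ∈ [h₁, h₂]` (`0 < h₁`, `h₂ ≤ 4`)
the solution of the limiting system (5.32) satisfies `∫₀^Λ p̂_0(σ)² dσ ≥ C` (so (5.33),
`∫₀^λ ∑_b γ_b p̂_b² ≥ C`, holds a fortiori). Printed: positivity (5.34) plus "a compactness argument and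
the fact that the solution of (5.32) depends continuously on the initial condition"; here
`{Ĥ ∈ [h₁, h₂]}` is compact since `Ĥ` is coercive for `lam > 0`.
[cite: CuneoEckmannHairerReyBellet2018, Prop 5.14] -/
theorem exists_pos_le_dissipation_limitFlow {N : ℕ} (hN : 0 < N) {Λ h₁ h₂ : ℝ} (hΛ : 0 < Λ)
    (hh₁ : 0 < h₁) (hh₂ : h₂ ≤ 4) :
    ∃ C : ℝ, 0 < C ∧ ∀ x : PhaseSpace N, (scaledChain ω₂ lam β 0).hamiltonian N x ∈ Icc h₁ h₂ →
      C ≤ ∫ σ in (0 : ℝ)..Λ, (limitFlow ω₂ lam β N x σ).2 ⟨0, hN⟩ ^ 2 := by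
  set P := scaledChain ω₂ lam β 0 with hP
  set K : Set (PhaseSpace N) := {x | P.hamiltonian N x ∈ Icc h₁ h₂} with hK
  set D : PhaseSpace N → ℝ := fun x => ∫ σ in (0 : ℝ)..Λ, (limitFlow ω₂ lam β N x σ).2 ⟨0, hN⟩ ^ 2 with hD
  have hHc : Continuous (P.hamiltonian N) := P.continuous_hamiltonian
    (scaledChain_contDiff_U ω₂ lam β 0 (n := 0)).continuous (scaledChain_contDiff_V ω₂ lam β 0 (n := 0)).continuous N
  have hKc : IsCompact K := by
    refine Metric.isCompact_of_isClosed_isBounded (isClosed_Icc.preimage hHc) ?_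
    refine (Metric.isBounded_closedBall (x := (0 : PhaseSpace N)) (r := limitRadius lam)).subset fun x hx => ?_
    rw [mem_closedBall, dist_zero_right]
    have hb := scaledChain_norm_le_of_hamiltonian_le ω₂ lam β 0 le_rfl (by rw [zero_mul]) hl hβ.le N
      (x := x) (h := 4) (hx.2.trans hh₂)
    unfold limitRadius
    linarith
  have hDc : Continuous D := continuous_dissipation_limitFlow ω₂ lam β N ⟨0, hN⟩ Λ
  by_cases hne : K.Nonempty
  · obtain ⟨x₀, hx₀, hmin⟩ := hKc.exists_isMinOn hne hDc.continuousOn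
    refine ⟨D x₀, dissipation_limitFlow_pos ω₂ hl hβ hN hΛ (hx₀.2.trans hh₂) (hh₁.trans_le hx₀.1),
      fun x hx => ?_⟩
    exact hmin hx
  · refine ⟨1, one_pos, fun x hx => ?_⟩
    exact absurd ⟨x, hx⟩ hne

end Dissipation

end Literature.MathematicalPhysics.KineticTheory.HeatConduction
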